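import Summits.CriticalPhenomena.PercolationContinuityZ3.Theorems.PercNearOneGluingAdditiveGluingFingerML3Reductions
import Literature.Probability.LatticeModels.ProdBernoulliClusterLocality
import HarnessLib

/-! # Crux `PercNearOneGluing.AdditiveGluing` (stmt-CriticalPhenomena-4576) — detours through a block: reachability with the pairs at a block
# replaced by virtual pairs between its contact relays (seat (b) V⁺-form, depth prover `png-dp-vplus`)

Support file (`--supports stmt-CriticalPhenomena-4576`); no definitions, no named facts.  Infrastructure for the two-contact case of the finger
multi-edge Lemma 3 (`stub_fingerML3_vp`), where reliabilities in the un-glued weighting `K` (fingers separate) and in the glued weighting `K/N` must be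
expressed through ONE base weighting.

* `reach_detour_iff` — pointwise graph lemma.  `ω'` a set of pairs avoiding the block `N`, `O` any set of pairs (think: pairs meeting `N`), `Q` a set of pairs
  avoiding `N`.  If (a) the endpoints of every pair of `Q` are joined by the pairs of `O` alone, and (b) two vertices outside `N` joined by `O`
  alone are equal or joined by `Q` alone, then for `y, b ∉ N`: `y ↔ b` in `ω' ∪ O` iff `y ↔ b` in `ω' ∪ Q` (two closed-set inductions).
* `real_openConn_eq_of_blockPairs` — if a weighting `p` gives weight `1` to the pairs of `O` and weight `0` to every other pair meeting `N`, then
  almost surely the open pairs meeting `N` are exactly `O`, so `μ_p(y ↔ b) = μ_{p}{ω | y ↔ b in (ω ∖ pairs at N) ∪ Q} = μ_{q}{same}` for ANY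
  weighting `q` agreeing with `p` off the block (`prodBernoulli_real_eq_of_determinedBy`).
These turn the pattern weightings of the un-glued and glued finger systems into base quantities of the form `μ_q{y ↔ b in (ω∖N-pairs) ∪ Q}` with
`Q = ∅` (no bridge / one contact relay touched) or `Q = {s(w₁,w₂)}` (a finger bridging two relays / both relays touched by the glued block).
[folklore; Grimmett 1999 §1.3–2.2; KozmaNitzan2024 §3.1 (gluing), §4 p. 20 (conditioning on patterns)]
-/

namespace Summit.CriticalPhenomena.PercolationContinuityZ3.Theorems

open MeasureTheory Set
open Literature.Probability.LatticeModels (prodBernoulli)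
open Literature.Probability.Percolation (BondConfig openConn openGraph pinW localCylinder DeterminedBy determinedBy_iff)

noncomputable section
open Classical

section FingerBridgeGraph

open Literature.Probability.LatticeModels Literature.Probability.Percolation

variable {n : ℕ}

/-! ### The detour lemma -/

/-- One direction of the detour lemma: a walk in `ω' ∪ Q` is simulated in `ω' ∪ O` when every `Q`-pair is `O`-connected. [folklore] -/
theorem reach_of_detour_left {ω' O Q : Set (Sym2 (Fin n))}
    (ha : ∀ e ∈ Q, ∀ u ∈ e, ∀ u' ∈ e, (openGraph O).Reachable u u') {y b : Fin n}
    (h : (openGraph (ω' ∪ Q : BondConfig (Fin n))).Reachable y b) :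
    (openGraph (ω' ∪ O : BondConfig (Fin n))).Reachable y b := by
  obtain ⟨p⟩ := h
  suffices key : ∀ (u v : Fin n) (q : (openGraph (ω' ∪ Q : BondConfig (Fin n))).Walk u v),
      (openGraph (ω' ∪ O : BondConfig (Fin n))).Reachable y u → (openGraph (ω' ∪ O : BondConfig (Fin n))).Reachable y v from
    key y b p (SimpleGraph.Reachable.refl _)
  intro u v q
  induction q with
  | nil => exact id
  | cons hadj q ih =>
    intro hu
    refine ih ?_
    rename_i u' w' _
    obtain ⟨hmem, hne⟩ := (openGraph_adj _ u' w').1 hadj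
    rcases hmem with hω | hQ
    · exact hu.trans ((openGraph_adj _ u' w').2 ⟨Or.inl hω, hne⟩).reachable
    · have hO : (openGraph O).Reachable u' w' := ha _ hQ u' (Sym2.mem_mk_left u' w') w' (Sym2.mem_mk_right u' w')
      exact hu.trans (hO.mono (SimpleGraph.fromEdgeSet_mono Set.subset_union_right))

/-- **The detour lemma.**  `ω'` avoids `N`, every pair of `O` meets `N`, `Q` avoids `N`; (a) every `Q`-pair is `O`-connected; (b) two vertices
outside `N` that are `O`-connected are equal or `Q`-connected.  Then for `y, b ∉ N`: `y ↔ b` in `ω' ∪ O` iff `y ↔ b` in `ω' ∪ Q`. [folklore] -/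
theorem reach_detour_iff (N : Finset (Fin n)) {ω' O Q : Set (Sym2 (Fin n))}
    (hω' : ∀ e ∈ ω', ∀ z ∈ e, z ∉ N) (hQ : ∀ e ∈ Q, ∀ z ∈ e, z ∉ N)
    (ha : ∀ e ∈ Q, ∀ u ∈ e, ∀ u' ∈ e, (openGraph O).Reachable u u')
    (hb : ∀ u u' : Fin n, u ∉ N → u' ∉ N → (openGraph O).Reachable u u' → (openGraph Q).Reachable u u')
    {y b : Fin n} (hy : y ∉ N) (hbN : b ∉ N) :
    (openGraph (ω' ∪ O : BondConfig (Fin n))).Reachable y b ↔ (openGraph (ω' ∪ Q : BondConfig (Fin n))).Reachable y b := by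
  have _ := hQ
  refine ⟨fun h => ?_, reach_of_detour_left ha⟩
  -- closed-set induction: outside vertices reachable in `ω' ∪ Q`, block vertices `O`-attached to such a vertex
  obtain ⟨p⟩ := h
  let S : Set (Fin n) := fun z =>
    (z ∉ N ∧ (openGraph (ω' ∪ Q : BondConfig (Fin n))).Reachable y z) ∨
      (z ∈ N ∧ ∃ u : Fin n, u ∉ N ∧ (openGraph (ω' ∪ Q : BondConfig (Fin n))).Reachable y u ∧ (openGraph O).Reachable u z)
  suffices key : ∀ (u v : Fin n) (q : (openGraph (ω' ∪ O : BondConfig (Fin n))).Walk u v), S u → S v by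
    have hyS : S y := Or.inl ⟨hy, SimpleGraph.Reachable.refl _⟩
    rcases key y b p hyS with ⟨-, h⟩ | ⟨hbN', -⟩
    · exact h
    · exact (hbN hbN').elim
  intro u v q
  induction q with
  | nil => exact id
  | cons hadj q ih =>
    intro hu
    refine ih ?_
    rename_i u' w' _
    obtain ⟨hmem, hne⟩ := (openGraph_adj _ u' w').1 hadj
    rcases hmem with hω | hOe
    · -- a pair of `ω'`: both endpoints outside `N`
      have hu'N : u' ∉ N := hω' _ hω u' (Sym2.mem_mk_left u' w')
      have hw'N : w' ∉ N := hω' _ hω w' (Sym2.mem_mk_right u' w')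
      rcases hu with ⟨-, hyu⟩ | ⟨hu'N', -⟩
      · exact Or.inl ⟨hw'N, hyu.trans ((openGraph_adj _ u' w').2 ⟨Or.inl hω, hne⟩).reachable⟩
      · exact (hu'N hu'N').elim
    · -- a pair of `O`
      have hOadj : (openGraph O).Reachable u' w' := ((openGraph_adj O u' w').2 ⟨hOe, hne⟩).reachable
      -- the `O`-attachment witness of `u'`
      have hwit : ∃ u : Fin n, u ∉ N ∧ (openGraph (ω' ∪ Q : BondConfig (Fin n))).Reachable y u ∧ (openGraph O).Reachable u u' := by
        rcases hu with ⟨hu'N, hyu⟩ | ⟨-, u, huN, hyu, huu'⟩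
        · exact ⟨u', hu'N, hyu, SimpleGraph.Reachable.refl _⟩
        · exact ⟨u, huN, hyu, huu'⟩
      obtain ⟨u, huN, hyu, huu'⟩ := hwit
      by_cases hw'N : w' ∈ N
      · exact Or.inr ⟨hw'N, u, huN, hyu, huu'.trans hOadj⟩
      · have hQr := hb u w' huN hw'N (huu'.trans hOadj)
        exact Or.inl ⟨hw'N, hyu.trans (hQr.mono (SimpleGraph.fromEdgeSet_mono Set.subset_union_right))⟩

/-! ### Almost surely the open pairs at the block are the sure ones -/

/-- If `p = 1` on the pairs of the finite set `O` and `p = 0` on every other pair meeting `N`, then almost surely the open pairs meeting `N` are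
exactly those of `O`, i.e. `ω = (ω ∖ pairs at N) ∪ O`. [folklore] -/
theorem ae_blockPairs_eq (p : Sym2 (Fin n) → unitInterval) (N : Finset (Fin n)) (O : Finset (Sym2 (Fin n)))
    (h1 : ∀ e ∈ O, p e = 1) (h0 : ∀ e : Sym2 (Fin n), e ∉ O → (∃ z ∈ e, z ∈ N) → p e = 0) :
    ∀ᵐ ω ∂(prodBernoulli p), (ω = ({e | e ∈ ω ∧ ∀ z ∈ e, z ∉ N} ∪ ↑O : Set (Sym2 (Fin n)))) := by
  have hO : ∀ᵐ ω ∂(prodBernoulli p), ∀ e ∈ O, e ∈ ω :=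
    Filter.eventually_all_finset O |>.2 fun e he => prodBernoulli_ae_mem_of_eq_one p (h1 e he)
  have hZ : ∀ᵐ ω ∂(prodBernoulli p), ∀ e ∈ (Finset.univ.filter fun e : Sym2 (Fin n) => e ∉ O ∧ ∃ z ∈ e, z ∈ N), e ∉ ω := by
    refine (Filter.eventually_all_finset _).2 fun e he => ?_
    obtain ⟨heO, hz⟩ := (Finset.mem_filter.1 he).2
    exact prodBernoulli_ae_notMem p (h0 e heO hz)
  filter_upwards [hO, hZ] with ω hωO hωZ
  ext e
  simp only [Set.mem_union, Set.mem_setOf_eq, Finset.mem_coe]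
  constructor
  · intro he
    by_cases heO : e ∈ O
    · exact Or.inr heO
    · left
      refine ⟨he, fun z hz hzN => ?_⟩
      exact hωZ e (Finset.mem_filter.2 ⟨Finset.mem_univ _, heO, z, hz, hzN⟩) he
  · rintro (⟨he, -⟩ | heO)
    · exact he
    · exact hωO e heO

/-- The event "`y ↔ b` in `(ω ∖ pairs at N) ∪ Q`" is determined by the pairs avoiding `N`. [folklore] -/
theorem determinedBy_reach_offBlock_union (N : Finset (Fin n)) (Q : Set (Sym2 (Fin n))) (y b : Fin n) :
    DeterminedBy {ω : BondConfig (Fin n) |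
        (openGraph (({e | e ∈ ω ∧ ∀ z ∈ e, z ∉ N} ∪ Q : Set (Sym2 (Fin n))) : BondConfig (Fin n))).Reachable y b}
      {e : Sym2 (Fin n) | ∀ z ∈ e, z ∉ N} := by
  rw [determinedBy_iff]
  intro ω₁ ω₂ h
  have : ({e | e ∈ ω₁ ∧ ∀ z ∈ e, z ∉ N} : Set (Sym2 (Fin n))) = {e | e ∈ ω₂ ∧ ∀ z ∈ e, z ∉ N} := by
    ext e
    have he := Set.ext_iff.1 h e
    simp only [Set.mem_inter_iff, Set.mem_setOf_eq] at he ⊢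
    constructor
    · rintro ⟨h1, h2⟩; exact ⟨(he.1 ⟨h1, h2⟩).1, h2⟩
    · rintro ⟨h1, h2⟩; exact ⟨(he.2 ⟨h1, h2⟩).1, h2⟩
  simp only [Set.mem_setOf_eq, this]

/-- **Reliability as a base quantity.**  `p = 1` on `O` (pairs meeting `N`), `p = 0` on the other pairs meeting `N`; `Q` avoids `N` and satisfies the
detour conditions (a), (b) w.r.t. `O`; `q` any weighting agreeing with `p` on the pairs avoiding `N`.  Then for `y, b ∉ N`:
`μ_p(y ↔ b) = μ_q{ω | y ↔ b in (ω ∖ pairs at N) ∪ Q}`. [folklore; KozmaNitzan2024 §4 p. 20] -/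
theorem real_openConn_eq_of_blockPairs (p q : Sym2 (Fin n) → unitInterval) (N : Finset (Fin n)) (O : Finset (Sym2 (Fin n)))
    (Q : Set (Sym2 (Fin n)))
    (h1 : ∀ e ∈ O, p e = 1) (h0 : ∀ e : Sym2 (Fin n), e ∉ O → (∃ z ∈ e, z ∈ N) → p e = 0)
    (hQ : ∀ e ∈ Q, ∀ z ∈ e, z ∉ N)
    (ha : ∀ e ∈ Q, ∀ u ∈ e, ∀ u' ∈ e, (openGraph (↑O : Set (Sym2 (Fin n)))).Reachable u u')
    (hb : ∀ u u' : Fin n, u ∉ N → u' ∉ N → (openGraph (↑O : Set (Sym2 (Fin n)))).Reachable u u' → (openGraph Q).Reachable u u')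
    (hpq : ∀ e : Sym2 (Fin n), (∀ z ∈ e, z ∉ N) → p e = q e) {y b : Fin n} (hy : y ∉ N) (hbN : b ∉ N) :
    (prodBernoulli p).real (openConn y b) =
      (prodBernoulli q).real {ω : BondConfig (Fin n) |
        (openGraph (({e | e ∈ ω ∧ ∀ z ∈ e, z ∉ N} ∪ Q : Set (Sym2 (Fin n))) : BondConfig (Fin n))).Reachable y b} := by
  set E : Set (BondConfig (Fin n)) := {ω : BondConfig (Fin n) |
    (openGraph (({e | e ∈ ω ∧ ∀ z ∈ e, z ∉ N} ∪ Q : Set (Sym2 (Fin n))) : BondConfig (Fin n))).Reachable y b} with hE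
  -- almost surely `{y ↔ b} = E` under `p`
  have hae : ∀ᵐ ω ∂(prodBernoulli p), ω ∈ (openConn y b : Set (BondConfig (Fin n))) ↔ ω ∈ E := by
    filter_upwards [ae_blockPairs_eq p N O h1 h0] with ω hω
    have hω' : ∀ e ∈ ({e | e ∈ ω ∧ ∀ z ∈ e, z ∉ N} : Set (Sym2 (Fin n))), ∀ z ∈ e, z ∉ N := fun e he => he.2
    have key := reach_detour_iff N (ω' := {e | e ∈ ω ∧ ∀ z ∈ e, z ∉ N}) (O := (↑O : Set (Sym2 (Fin n)))) (Q := Q)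
      hω' hQ ha hb hy hbN
    have hre : openGraph ω = openGraph (({e | e ∈ ω ∧ ∀ z ∈ e, z ∉ N} ∪ ↑O : Set (Sym2 (Fin n))) : BondConfig (Fin n)) := by
      rw [← hω]
    show (openGraph ω).Reachable y b ↔ _
    rw [hre]
    exact key
  have heq : (openConn y b : Set (BondConfig (Fin n))) =ᵐ[prodBernoulli p] E := hae.mono fun ω h => propext h
  rw [measureReal_congr heq]
  exact prodBernoulli_real_eq_of_determinedBy p q (fun e he => hpq e he) (determinedBy_reach_offBlock_union N Q y b)
    MeasurableSet.of_discrete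

end FingerBridgeGraph

end

end Summit.CriticalPhenomena.PercolationContinuityZ3.Theorems
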